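/-
Copyright (c) 2026 the pub-hodgecm-mathlib formalisation cell (harness21).  Prover seat hodgecm-mathlib-LH4-p08 (g11) (valve hand), Track B «K2-LIT»,
#184♮ = hLiu418 = `stmt-HodgeConjecture-24832`; socket #41, KIND W — (KW-arch-hBL) brick (3d-i) FILE 2b′ (KW desk F0P2-p08 (g4) 01:27:44Z): the two heads.
THEOREMS ONLY (no `def`, no `instance`, no notation, no named-fact hypothesis, no `sorry`).
-/
import Summits.HodgeConjecture.HodgeConjecture.Theorems.K2LiuKindWArchWhittakerGrowthAtOnePic   -- the engine (family + uniform constants, generic picture)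
import HarnessLib

/-!
# Crux `HLiu418`, socket #41, KIND W — `K2LiuKindWArchWhittakerGrowthAtOne`: GROWTH CONSTANTS UNIFORM IN `g` FOR THE CONTINUED PER-PLACE WHITTAKER LETTERS,
# POSITIVE AND NEGATIVE DEFINITE FRAMED INDEX

Cell `hodgecm-mathlib`, crux item hLiu418 = `stmt-HodgeConjecture-24832` (helper lane `--supports … --as helper`, count-neutral), route of record `HCCMUnconditional`;
squad K2 ∕ K2Liu, road `K2_Liu`, socket #41, KIND W, (iii-arch) block letter `hBL`.  Brick (3d-i) of the KW desk's map (K2E4-p10 (g10)'s finding, K2 bus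
01:24:20Z; desk 01:25:09Z (A), 01:27:44Z): ★ FILE 2b∕2c's growth constants may depend on `g`; here they are ∃-bound BEFORE `∀ g`, over the SIEGEL-FORM
decompositions `diag(C,−B)·g = n(X₀)·diag(R,R⁻¹)` (`u₀ = 1`, K-picture polynomial `P(1)` fixed once).
* **`exists_growth_constants_of_posDef_at_one`** — ★ p863390∕★ 2b's binders minus `{g} (hg) {hidx} (hpos) {eb} (heb)` (quantified AFTER the constants,
  KW desk 01:37:39Z): a FAMILY `Ew : (hidx, g) ↦ Ew hidx g` (holomorphy on `{0<re}` and the formula for every positive definite index and every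
  `g ∈ U(J)`) and the (ii″) face with constants uniform in `hidx` and `g`
  (★ `K2LiuKindWArchWhittakerGrowthAtOnePic.exists_growth_constants_of_posDef_pic` at the `evalAt … Q` picture);
* **`exists_growth_constants_of_negDef_at_one`** — the SAME at `(-hidx).PosDef`, in the ORIGINAL letters: by the block-sign mirror `θ y = D·y·D` (★ p863756 §2)
  the family is `Ew hidx g := Ew′ (−hidx) (θ g)` for the engine's family `Ew′` at `θx` and the mirrored picture; a Siegel-form
  decomposition `(X₀, R)` of `diag(C,−B)·g` transports to the Siegel-form decomposition `(−X₀, −R)` of `diag(−C, B)·θg` (`θ(1)·(−1)` absorbed into `R ↦ −R`,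
  `(−R)⁻¹ = −R⁻¹`), with `‖det(−R)‖ = ‖det R‖` and `(−R)·(−h₁)·(−R) = −(R h₁ R)` (entrywise norms and `‖det‖` unchanged).
[Shimura1997, §16.4, §18.4] [KudlaRallis1994, §1].
HONEST LABEL.  Count-neutral helper, closes no socket: `HC_CM` is proved only modulo the 7 printed citations (2 remaining named inputs: hLiu418 =
`stmt-HodgeConjecture-24832`, h413 = `stmt-HodgeConjecture-24833`) until rung 0 closes.
-/

set_option autoImplicit false
set_option linter.dupNamespace false -- the mandated namespace repeats `HodgeConjecture.HodgeConjecture`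

noncomputable section

open Complex Matrix MeasureTheory
open scoped ComplexConjugate ComplexOrder
open Literature.NumberTheory.ModularForms.SiegelUpperHalfSpace (moeb)

namespace Summit.HodgeConjecture.HodgeConjecture.Cruxes.HLiu418.K2LiuKindWArchWhittakerGrowthAtOne

open Summit.HodgeConjecture.HodgeConjecture.Cruxes.HLiu418.K2LiuArchInducedTubeDefs
open Summit.HodgeConjecture.HodgeConjecture.Cruxes.HLiu418.K2LiuU22CompactPictureDefs
open Summit.HodgeConjecture.HodgeConjecture.Cruxes.HLiu418.K2LiuKindWArchWhittakerLetterNegDef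
open Summit.HodgeConjecture.HodgeConjecture.Cruxes.HLiu418.K2LiuKindWArchWhittakerGrowthAtOnePic (exists_growth_constants_of_posDef_pic)

/-- **GROWTH CONSTANTS UNIFORM IN THE INDEX AND IN `g` — POSITIVE DEFINITE FRAMED INDEX (signature (2,0)).**  ★ p863390 ∕ ★ 2b's binders minus
`{g} (hg) {hidx} (hpos) {eb} (heb)` (they are quantified AFTER the constants); the family `Ew : (hidx, g) ↦ Ew hidx g` of continuations (holomorphy on
`{0<re}` and the formula for every positive definite index and every `g ∈ U(J)`), and the (ii″) face with the constants ∃-bound BEFORE `∀ hidx ∀ g` over the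
Siegel-form decompositions `diag(C,−B)·g = n(X₀)·diag(R,R⁻¹)`. [cite: Shimura1997, §16.4, §18.4] [cite: KudlaRallis1994, §1] -/
theorem exists_growth_constants_of_posDef_at_one {k : ℤ} (hk : -2 ≤ k) (Q : Carrier)
    {B C : Matrix (Fin 2) (Fin 2) ℂ}
    (hx : (fromBlocks 0 B C 0 : Matrix (Fin 2 ⊕ Fin 2) (Fin 2 ⊕ Fin 2) ℂ)ᴴ * Matrix.J (Fin 2) ℂ * (fromBlocks 0 B C 0 : Matrix (Fin 2 ⊕ Fin 2) (Fin 2 ⊕ Fin 2) ℂ) =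
      Matrix.J (Fin 2) ℂ)
    (hKpic : ∀ k₀ : Matrix (Fin 2 ⊕ Fin 2) (Fin 2 ⊕ Fin 2) ℂ, k₀ᴴ * Matrix.J (Fin 2) ℂ * k₀ = Matrix.J (Fin 2) ℂ →
      moeb k₀ (I • (1 : Matrix (Fin 2) (Fin 2) ℂ)) = I • 1 →
      ∃ P : MvPolynomial (((Fin 2 ⊕ Fin 2) × (Fin 2 ⊕ Fin 2)) ⊕ ((Fin 2 ⊕ Fin 2) × (Fin 2 ⊕ Fin 2))) ℂ,
        ∀ (s : ℂ) (F : Matrix (Fin 2 ⊕ Fin 2) (Fin 2 ⊕ Fin 2) ℂ → ℂ), IsArchSiegelSection (fun z : ℂ => (conj z / ((‖z‖ : ℝ) : ℂ)) ^ k) s F →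
          (∀ (v : Matrix (Fin 2) (Fin 2) ℂ), vᴴ * v = 1 → ∀ hv : v.det ≠ 0,
            F ((2 : ℂ)⁻¹ • fromBlocks (1 + v) (-(I • (1 - v))) (I • (1 - v)) (1 + v) : Matrix (Fin 2 ⊕ Fin 2) (Fin 2 ⊕ Fin 2) ℂ) = evalAt v hv Q) →
          ∀ u : Matrix (Fin 2 ⊕ Fin 2) (Fin 2 ⊕ Fin 2) ℂ, uᴴ * Matrix.J (Fin 2) ℂ * u = Matrix.J (Fin 2) ℂ → moeb u (I • (1 : Matrix (Fin 2) (Fin 2) ℂ)) = I • 1 →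
            F (u * k₀) = MvPolynomial.eval (Sum.elim (fun pq => u pq.1 pq.2) (fun pq => conj (u pq.1 pq.2))) P) :
    ∃ Ew : Matrix (Fin 2) (Fin 2) ℂ → Matrix (Fin 2 ⊕ Fin 2) (Fin 2 ⊕ Fin 2) ℂ → ℂ → ℂ,
      (∀ hidx : Matrix (Fin 2) (Fin 2) ℂ, hidx.PosDef → ∀ eb : Matrix (Fin 2) (Fin 2) ℂ → ℂ, (∀ b, eb b = cexp (-(2 * Real.pi * I) * (hidx * b).trace)) →
        ∀ g : Matrix (Fin 2 ⊕ Fin 2) (Fin 2 ⊕ Fin 2) ℂ, gᴴ * Matrix.J (Fin 2) ℂ * g = Matrix.J (Fin 2) ℂ →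
        DifferentiableOn ℂ (Ew hidx g) {s : ℂ | 0 < s.re} ∧
        ∃ s₀ : ℝ, ∀ s : ℂ, s₀ < s.re →
          ∀ F : Matrix (Fin 2 ⊕ Fin 2) (Fin 2 ⊕ Fin 2) ℂ → ℂ, IsArchSiegelSection (fun z : ℂ => (conj z / ((‖z‖ : ℝ) : ℂ)) ^ k) s F →
            (∀ (v : Matrix (Fin 2) (Fin 2) ℂ), vᴴ * v = 1 → ∀ hv : v.det ≠ 0,
              F ((2 : ℂ)⁻¹ • fromBlocks (1 + v) (-(I • (1 - v))) (I • (1 - v)) (1 + v) : Matrix (Fin 2 ⊕ Fin 2) (Fin 2 ⊕ Fin 2) ℂ) = evalAt v hv Q) →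
            ∫ r : Fin 2 → Fin 2 → ℝ, F ((fromBlocks 0 B C 0 : Matrix (Fin 2 ⊕ Fin 2) (Fin 2 ⊕ Fin 2) ℂ) * fromBlocks 1 (hermOfReal r) 0 1 * g) * eb (hermOfReal r) =
              Ew hidx g s) ∧
      ∀ z : ℂ, 0 < z.re → ∃ Cg cg N N' r : ℝ, 0 ≤ Cg ∧ 0 < cg ∧ 0 ≤ N ∧ 0 ≤ N' ∧ 0 < r ∧
        ∀ hidx : Matrix (Fin 2) (Fin 2) ℂ, hidx.PosDef → ∀ eb : Matrix (Fin 2) (Fin 2) ℂ → ℂ, (∀ b, eb b = cexp (-(2 * Real.pi * I) * (hidx * b).trace)) →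
        ∀ g : Matrix (Fin 2 ⊕ Fin 2) (Fin 2 ⊕ Fin 2) ℂ, gᴴ * Matrix.J (Fin 2) ℂ * g = Matrix.J (Fin 2) ℂ →
          ∀ (X₀ R : Matrix (Fin 2) (Fin 2) ℂ), X₀ᴴ = X₀ → Rᴴ = R → IsUnit R.det →
            (fromBlocks C 0 0 (-B) : Matrix (Fin 2 ⊕ Fin 2) (Fin 2 ⊕ Fin 2) ℂ) * g = fromBlocks 1 X₀ 0 1 * fromBlocks R 0 0 R⁻¹ →
            ∀ s : ℂ, dist s z < r →
              ‖Ew hidx g s‖ ≤ Cg * ‖R.det‖ ^ (2 - 2 * s.re) * Real.exp (-(cg * ∑ a, ∑ b, ‖(R * ((C⁻¹)ᴴ * hidx * C⁻¹) * R) a b‖)) *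
                (1 + ∑ a, ∑ b, ‖(R * ((C⁻¹)ᴴ * hidx * C⁻¹) * R) a b‖) ^ N * (1 + ‖(R * ((C⁻¹)ᴴ * hidx * C⁻¹) * R).det‖ ^ (-N')) :=
  exists_growth_constants_of_posDef_pic hk
    (fun (_ : ℂ) (F : Matrix (Fin 2 ⊕ Fin 2) (Fin 2 ⊕ Fin 2) ℂ → ℂ) => ∀ (v : Matrix (Fin 2) (Fin 2) ℂ), vᴴ * v = 1 → ∀ hv : v.det ≠ 0,
      F ((2 : ℂ)⁻¹ • fromBlocks (1 + v) (-(I • (1 - v))) (I • (1 - v)) (1 + v) : Matrix (Fin 2 ⊕ Fin 2) (Fin 2 ⊕ Fin 2) ℂ) = evalAt v hv Q)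
    hx hKpic

/-- **GROWTH CONSTANTS UNIFORM IN THE INDEX AND IN `g` — NEGATIVE DEFINITE FRAMED INDEX (signature (0,2)).**  The SAME conclusion at `(-hidx).PosDef`, in
the ORIGINAL letters (block-sign mirror: family `Ew hidx g := Ew′ (−hidx) (θg)`, Siegel-form decompositions transported by `(X₀, R) ↦ (−X₀, −R)`).
[cite: Shimura1997, §16.4, §18.4] [cite: KudlaRallis1994, §1] -/
theorem exists_growth_constants_of_negDef_at_one {k : ℤ} (hk : -2 ≤ k) (Q : Carrier)
    {B C : Matrix (Fin 2) (Fin 2) ℂ}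
    (hx : (fromBlocks 0 B C 0 : Matrix (Fin 2 ⊕ Fin 2) (Fin 2 ⊕ Fin 2) ℂ)ᴴ * Matrix.J (Fin 2) ℂ * (fromBlocks 0 B C 0 : Matrix (Fin 2 ⊕ Fin 2) (Fin 2 ⊕ Fin 2) ℂ) =
      Matrix.J (Fin 2) ℂ)
    (hKpic : ∀ k₀ : Matrix (Fin 2 ⊕ Fin 2) (Fin 2 ⊕ Fin 2) ℂ, k₀ᴴ * Matrix.J (Fin 2) ℂ * k₀ = Matrix.J (Fin 2) ℂ →
      moeb k₀ (I • (1 : Matrix (Fin 2) (Fin 2) ℂ)) = I • 1 →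
      ∃ P : MvPolynomial (((Fin 2 ⊕ Fin 2) × (Fin 2 ⊕ Fin 2)) ⊕ ((Fin 2 ⊕ Fin 2) × (Fin 2 ⊕ Fin 2))) ℂ,
        ∀ (s : ℂ) (F : Matrix (Fin 2 ⊕ Fin 2) (Fin 2 ⊕ Fin 2) ℂ → ℂ), IsArchSiegelSection (fun z : ℂ => (conj z / ((‖z‖ : ℝ) : ℂ)) ^ k) s F →
          (∀ (v : Matrix (Fin 2) (Fin 2) ℂ), vᴴ * v = 1 → ∀ hv : v.det ≠ 0,
            F ((2 : ℂ)⁻¹ • fromBlocks (1 + v) (-(I • (1 - v))) (I • (1 - v)) (1 + v) : Matrix (Fin 2 ⊕ Fin 2) (Fin 2 ⊕ Fin 2) ℂ) = evalAt v hv Q) →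
          ∀ u : Matrix (Fin 2 ⊕ Fin 2) (Fin 2 ⊕ Fin 2) ℂ, uᴴ * Matrix.J (Fin 2) ℂ * u = Matrix.J (Fin 2) ℂ → moeb u (I • (1 : Matrix (Fin 2) (Fin 2) ℂ)) = I • 1 →
            F (u * k₀) = MvPolynomial.eval (Sum.elim (fun pq => u pq.1 pq.2) (fun pq => conj (u pq.1 pq.2))) P) :
    ∃ Ew : Matrix (Fin 2) (Fin 2) ℂ → Matrix (Fin 2 ⊕ Fin 2) (Fin 2 ⊕ Fin 2) ℂ → ℂ → ℂ,
      (∀ hidx : Matrix (Fin 2) (Fin 2) ℂ, (-hidx).PosDef → ∀ eb : Matrix (Fin 2) (Fin 2) ℂ → ℂ, (∀ b, eb b = cexp (-(2 * Real.pi * I) * (hidx * b).trace)) →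
        ∀ g : Matrix (Fin 2 ⊕ Fin 2) (Fin 2 ⊕ Fin 2) ℂ, gᴴ * Matrix.J (Fin 2) ℂ * g = Matrix.J (Fin 2) ℂ →
        DifferentiableOn ℂ (Ew hidx g) {s : ℂ | 0 < s.re} ∧
        ∃ s₀ : ℝ, ∀ s : ℂ, s₀ < s.re →
          ∀ F : Matrix (Fin 2 ⊕ Fin 2) (Fin 2 ⊕ Fin 2) ℂ → ℂ, IsArchSiegelSection (fun z : ℂ => (conj z / ((‖z‖ : ℝ) : ℂ)) ^ k) s F →
            (∀ (v : Matrix (Fin 2) (Fin 2) ℂ), vᴴ * v = 1 → ∀ hv : v.det ≠ 0,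
              F ((2 : ℂ)⁻¹ • fromBlocks (1 + v) (-(I • (1 - v))) (I • (1 - v)) (1 + v) : Matrix (Fin 2 ⊕ Fin 2) (Fin 2 ⊕ Fin 2) ℂ) = evalAt v hv Q) →
            ∫ r : Fin 2 → Fin 2 → ℝ, F ((fromBlocks 0 B C 0 : Matrix (Fin 2 ⊕ Fin 2) (Fin 2 ⊕ Fin 2) ℂ) * fromBlocks 1 (hermOfReal r) 0 1 * g) * eb (hermOfReal r) =
              Ew hidx g s) ∧
      ∀ z : ℂ, 0 < z.re → ∃ Cg cg N N' r : ℝ, 0 ≤ Cg ∧ 0 < cg ∧ 0 ≤ N ∧ 0 ≤ N' ∧ 0 < r ∧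
        ∀ hidx : Matrix (Fin 2) (Fin 2) ℂ, (-hidx).PosDef → ∀ eb : Matrix (Fin 2) (Fin 2) ℂ → ℂ, (∀ b, eb b = cexp (-(2 * Real.pi * I) * (hidx * b).trace)) →
        ∀ g : Matrix (Fin 2 ⊕ Fin 2) (Fin 2 ⊕ Fin 2) ℂ, gᴴ * Matrix.J (Fin 2) ℂ * g = Matrix.J (Fin 2) ℂ →
          ∀ (X₀ R : Matrix (Fin 2) (Fin 2) ℂ), X₀ᴴ = X₀ → Rᴴ = R → IsUnit R.det →
            (fromBlocks C 0 0 (-B) : Matrix (Fin 2 ⊕ Fin 2) (Fin 2 ⊕ Fin 2) ℂ) * g = fromBlocks 1 X₀ 0 1 * fromBlocks R 0 0 R⁻¹ →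
            ∀ s : ℂ, dist s z < r →
              ‖Ew hidx g s‖ ≤ Cg * ‖R.det‖ ^ (2 - 2 * s.re) * Real.exp (-(cg * ∑ a, ∑ b, ‖(R * ((C⁻¹)ᴴ * hidx * C⁻¹) * R) a b‖)) *
                (1 + ∑ a, ∑ b, ‖(R * ((C⁻¹)ᴴ * hidx * C⁻¹) * R) a b‖) ^ N * (1 + ‖(R * ((C⁻¹)ᴴ * hidx * C⁻¹) * R).det‖ ^ (-N')) := by
  -- the mirrored frame `θx`, the mirrored picture and bridge (as in ★ p863756 §3); the engine's family `Ew′` there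
  have hx' : (fromBlocks 0 (-B) (-C) 0 : Matrix (Fin 2 ⊕ Fin 2) (Fin 2 ⊕ Fin 2) ℂ)ᴴ * Matrix.J (Fin 2) ℂ *
      (fromBlocks 0 (-B) (-C) 0 : Matrix (Fin 2 ⊕ Fin 2) (Fin 2 ⊕ Fin 2) ℂ) = Matrix.J (Fin 2) ℂ := by
    have h := conjBlockSign_mem_UJ hx
    rwa [blockSign_mul_antidiag_mul_blockSign] at h
  obtain ⟨Ew, hEw, hgr⟩ := exists_growth_constants_of_posDef_pic hk
    (fun (s : ℂ) (G : Matrix (Fin 2 ⊕ Fin 2) (Fin 2 ⊕ Fin 2) ℂ → ℂ) => ∀ (v : Matrix (Fin 2) (Fin 2) ℂ), vᴴ * v = 1 → ∀ hv : v.det ≠ 0,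
      G ((fromBlocks 1 0 0 (-1) : Matrix (Fin 2 ⊕ Fin 2) (Fin 2 ⊕ Fin 2) ℂ) *
          ((2 : ℂ)⁻¹ • fromBlocks (1 + v) (-(I • (1 - v))) (I • (1 - v)) (1 + v) : Matrix (Fin 2 ⊕ Fin 2) (Fin 2 ⊕ Fin 2) ℂ) * fromBlocks 1 0 0 (-1)) =
        evalAt v hv Q)
    hx'
    (kPicture_conjBlockSign (k := k)
      (fun (s : ℂ) (F : Matrix (Fin 2 ⊕ Fin 2) (Fin 2 ⊕ Fin 2) ℂ → ℂ) => ∀ (v : Matrix (Fin 2) (Fin 2) ℂ), vᴴ * v = 1 → ∀ hv : v.det ≠ 0,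
        F ((2 : ℂ)⁻¹ • fromBlocks (1 + v) (-(I • (1 - v))) (I • (1 - v)) (1 + v) : Matrix (Fin 2 ⊕ Fin 2) (Fin 2 ⊕ Fin 2) ℂ) = evalAt v hv Q)
      hKpic)
  -- the family: `Ew′ (−hidx) (θ g)`
  refine ⟨fun hidx g => Ew (-hidx) ((fromBlocks 1 0 0 (-1) : Matrix (Fin 2 ⊕ Fin 2) (Fin 2 ⊕ Fin 2) ℂ) * g * fromBlocks 1 0 0 (-1)),
    fun hidx hneg eb heb g hg => ?_, fun z hz => ?_⟩
  · -- holomorphy and the formula: `F = (F∘θ)∘θ`, `F∘θ` is flat with the mirrored picture, then `r ↦ −r` on the chart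
    beta_reduce
    have heb' : ∀ b : Matrix (Fin 2) (Fin 2) ℂ, (fun b' : Matrix (Fin 2) (Fin 2) ℂ => eb (-b')) b = cexp (-(2 * Real.pi * I) * (-hidx * b).trace) := by
      intro b
      simp only [heb, Matrix.neg_mul, Matrix.mul_neg]
    obtain ⟨hhol, s₀, hform⟩ := hEw (-hidx) hneg _ heb' _ (conjBlockSign_mem_UJ hg)
    refine ⟨hhol, s₀, fun s hs F hF hFQ => ?_⟩
    have key := hform s hs (fun y => F ((fromBlocks 1 0 0 (-1) : Matrix (Fin 2 ⊕ Fin 2) (Fin 2 ⊕ Fin 2) ℂ) * y * fromBlocks 1 0 0 (-1)))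
      (isArchSiegelSection_conjBlockSign hF)
      (fun v hv hdv => by
        simpa only [Matrix.mul_assoc, blockSign_mul_blockSign_mul, blockSign_mul_blockSign, Matrix.mul_one] using hFQ v hv hdv)
    rw [← key]
    refine Eq.trans ?_ (integral_neg_eq_self _ volume)
    congr 1
    funext r
    simp only [hermOfReal_neg, neg_neg]
    rw [← blockSign_mul_antidiag_mul_blockSign B C, ← blockSign_mul_transl_mul_blockSign (hermOfReal r)]
    simp only [Matrix.mul_assoc, blockSign_mul_blockSign_mul, blockSign_mul_blockSign, Matrix.mul_one]
  · -- the uniform growth: transport the Siegel-form decomposition `(X₀, R)` of `diag(C,−B)·g` to `(−X₀, −R)` of `diag(−C,B)·θg`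
    obtain ⟨Cg, cg, N, N', r, hCg, hcg, hN, hN', hr, hface⟩ := hgr z hz
    refine ⟨Cg, cg, N, N', r, hCg, hcg, hN, hN', hr, fun hidx hneg eb heb g hg X₀ R hX₀ hR hRu hdec s hs => ?_⟩
    beta_reduce
    have heb' : ∀ b : Matrix (Fin 2) (Fin 2) ℂ, (fun b' : Matrix (Fin 2) (Fin 2) ℂ => eb (-b')) b = cexp (-(2 * Real.pi * I) * (-hidx * b).trace) := by
      intro b
      simp only [heb, Matrix.neg_mul, Matrix.mul_neg]
    obtain ⟨-, hBC⟩ := K2LiuArchBlockOfFrame.antidiag_letters hx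
    have hCu : IsUnit C.det := isUnit_iff_ne_zero.2 (Matrix.isUnit_det_of_left_inverse hBC).ne_zero
    have hCiC : C⁻¹ * C = 1 := Matrix.nonsing_inv_mul C hCu
    have hRneg : (-R)⁻¹ = -R⁻¹ := Matrix.inv_eq_left_inv (by rw [neg_mul_neg, Matrix.nonsing_inv_mul R hRu])
    have hdetnegR : (-R).det = R.det := by
      rw [Matrix.det_neg, Fintype.card_fin]; norm_num
    have hX₀' : (-X₀)ᴴ = -X₀ := by rw [conjTranspose_neg, hX₀]
    have hR' : (-R)ᴴ = -R := by rw [conjTranspose_neg, hR]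
    have hRu' : IsUnit (-R).det := by rw [hdetnegR]; exact hRu
    -- the transported decomposition
    have e1 : (fromBlocks (-C) 0 0 (-(-B)) : Matrix (Fin 2 ⊕ Fin 2) (Fin 2 ⊕ Fin 2) ℂ) * (fromBlocks 1 0 0 (-1) : Matrix (Fin 2 ⊕ Fin 2) (Fin 2 ⊕ Fin 2) ℂ) =
        -((fromBlocks 1 0 0 (-1) : Matrix (Fin 2 ⊕ Fin 2) (Fin 2 ⊕ Fin 2) ℂ) * fromBlocks C 0 0 (-B)) := by
      rw [fromBlocks_multiply, fromBlocks_multiply, fromBlocks_neg]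
      simp only [Matrix.mul_zero, Matrix.zero_mul, add_zero, zero_add, Matrix.one_mul, Matrix.mul_one, Matrix.mul_neg, Matrix.neg_mul, neg_neg,
        neg_zero]
    have e2 : (fromBlocks 1 0 0 (-1) : Matrix (Fin 2 ⊕ Fin 2) (Fin 2 ⊕ Fin 2) ℂ) * fromBlocks 1 X₀ 0 1 * fromBlocks R 0 0 R⁻¹ =
        fromBlocks 1 (-X₀) 0 1 * fromBlocks R 0 0 R⁻¹ * (fromBlocks 1 0 0 (-1) : Matrix (Fin 2 ⊕ Fin 2) (Fin 2 ⊕ Fin 2) ℂ) := by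
      rw [fromBlocks_multiply, fromBlocks_multiply, fromBlocks_multiply, fromBlocks_multiply]
      simp only [Matrix.mul_zero, Matrix.zero_mul, add_zero, zero_add, Matrix.one_mul, Matrix.mul_one, Matrix.mul_neg, Matrix.neg_mul, neg_neg]
    have hdec' : (fromBlocks (-C) 0 0 (-(-B)) : Matrix (Fin 2 ⊕ Fin 2) (Fin 2 ⊕ Fin 2) ℂ) *
        ((fromBlocks 1 0 0 (-1) : Matrix (Fin 2 ⊕ Fin 2) (Fin 2 ⊕ Fin 2) ℂ) * g * fromBlocks 1 0 0 (-1)) =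
        fromBlocks 1 (-X₀) 0 1 * fromBlocks (-R) 0 0 (-R)⁻¹ := by
      calc (fromBlocks (-C) 0 0 (-(-B)) : Matrix (Fin 2 ⊕ Fin 2) (Fin 2 ⊕ Fin 2) ℂ) *
            ((fromBlocks 1 0 0 (-1) : Matrix (Fin 2 ⊕ Fin 2) (Fin 2 ⊕ Fin 2) ℂ) * g * fromBlocks 1 0 0 (-1))
          = -((fromBlocks 1 0 0 (-1) : Matrix (Fin 2 ⊕ Fin 2) (Fin 2 ⊕ Fin 2) ℂ) * ((fromBlocks C 0 0 (-B) : Matrix (Fin 2 ⊕ Fin 2) (Fin 2 ⊕ Fin 2) ℂ) * g) *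
              fromBlocks 1 0 0 (-1)) := by
            rw [← Matrix.mul_assoc, ← Matrix.mul_assoc, e1]
            simp only [Matrix.neg_mul, Matrix.mul_assoc]
        _ = -(fromBlocks 1 (-X₀) 0 1 * fromBlocks R 0 0 R⁻¹ *
              ((fromBlocks 1 0 0 (-1) : Matrix (Fin 2 ⊕ Fin 2) (Fin 2 ⊕ Fin 2) ℂ) * fromBlocks 1 0 0 (-1))) := by
            rw [hdec, ← Matrix.mul_assoc, e2]
            simp only [Matrix.mul_assoc]
        _ = fromBlocks 1 (-X₀) 0 1 * fromBlocks (-R) 0 0 (-R)⁻¹ := by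
            rw [blockSign_mul_blockSign, Matrix.mul_one, hRneg, ← Matrix.mul_neg, fromBlocks_neg, neg_zero]
    have hb := hface (-hidx) hneg _ heb' _ (conjBlockSign_mem_UJ hg) (-X₀) (-R) hX₀' hR' hRu' hdec' s hs
    -- `hidx ↦ −hidx`, `C ↦ −C`, `R ↦ −R`: entrywise norms and `‖det‖` are unchanged
    have hCneg : (-C)⁻¹ = -C⁻¹ := Matrix.inv_eq_left_inv (by rw [neg_mul_neg, hCiC])
    have hneg1 : (-R) * (((-C)⁻¹)ᴴ * (-hidx) * (-C)⁻¹) * (-R) = -(R * ((C⁻¹)ᴴ * hidx * C⁻¹) * R) := by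
      rw [hCneg, conjTranspose_neg]
      simp only [Matrix.neg_mul, Matrix.mul_neg, neg_neg]
    rw [hneg1, hdetnegR, Matrix.det_neg, norm_mul, norm_pow, norm_neg, norm_one, one_pow, one_mul] at hb
    simpa only [Matrix.neg_apply, norm_neg] using hb

end Summit.HodgeConjecture.HodgeConjecture.Cruxes.HLiu418.K2LiuKindWArchWhittakerGrowthAtOne

end
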